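import Summits.QuantumAdvantage.QuantumAdvantage.Theorems.SosSandwichQueryFourier
import HarnessLib

/-!
# `Q_T`: the TOP-LEVEL WEIGHT of a quantum acceptance probability is dominated by a top-level influence
(Escudero Gutiérrez's creation-operator argument, coefficient form, in the tree's `QQueryAlg` model)

Support theorem for route `SosSandwich`, crux `PseudoBoundedAA` (stmt-QuantumAdvantage-15237).  Part 1 (this file: the
one-step algebra — block difference operators `Δ_k`, the functional `Γ`, its recursion and norm step; Part 2 = file
`SosSandwichQueryTopLevelWeight` runs the induction and the pairing; Part 3 = file `SosSandwichQueryHomogeneousRung`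
identifies `B(U)` with `p̂(U)` and concludes the homogeneous rung on `Q_T`).  Overall statement:
for a `T`-query algorithm `A`, with `v_S` the vector Walsh coefficients of the final state (`QueryFourier.vfc`),
`Π` the projection onto the accepting basis states, and the TOP-LEVEL BILINEAR COEFFICIENTS
`B(U) = Σ_{R ⊆ U, |R| = T} ⟨Π v_R, Π v_{U∖R}⟩` (`|U| = 2T`; Part 2 identifies `B(U)` with the Walsh
coefficient `p̂(U)` of the acceptance probability), we prove the PAIRING BOUND

  `|Σ_{|U| = 2T} c_U B(U)| ≤ 1` whenever `Σ_{U ∋ k} |c_U|² ≤ 1` for every index `k`   (`pairing_le_one`),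

and hence `(Σ_{|U|=2T} |B(U)|²)² ≤ max_k Σ_{U ∋ k, |U| = 2T} |B(U)|²` (`exists_topWeight_sq_le`).

Proof (coefficient-space form of [EscuderoGutierrez2023, proof of Thm 1.6]; no completely-bounded norms): let
`Δ_k` be the `|−⟩`-part of the index-`k` block (`blockDiff`), so that at the new top level one oracle step reads
`v'_S = U Σ_{k ∈ S} Δ_k v_{S∖k}` (`QueryFourier.vfc_oracle_top`).  Put
`Γ_j(R) = Σ_{|R'| = j, R' ∩ R = ∅} c_{R ∪ R'} v^{(j)}_{R'}` for the state after `j` queries.  Then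
`Γ_{j+1}(R) = U_{j+1} Σ_{k ∉ R} Δ_k Γ_j(R ∪ k)`, the blocks are orthogonal and `Σ_k ‖Δ_k φ‖² ≤ ‖φ‖²`, so
`Σ_{|R| = 2T−j} ‖Γ_j(R)‖²` is at most `1` for all `1 ≤ j ≤ T` (the weight hypothesis enters at `j = 1`).  Finally
`Σ_U c_U B(U) = Σ_{|R| = T} ⟨Π v_R, Γ_T(R)⟩`, bounded by Cauchy–Schwarz and Parseval `Σ_S ‖v_S‖² = 1`.

Sources: EscuderoGutierrez2023 (arXiv:2304.06713) Thm 1.6 / Cor 1.7 and its proof (§4.2); BealsEtAl2001 Lemma 4.1.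
-/

noncomputable section

set_option linter.dupNamespace false

namespace Summit.QuantumAdvantage.QuantumAdvantage.Theorems.SosSandwich.QueryTopLevel

open Matrix Finset Literature.Computability.Cryptography Literature.Computability.QuantumComplexity
open Literature.Computability.Complexity.LowDegree Literature.Probability.RandomGraphs.LowDegree
open Summit.QuantumAdvantage.QuantumAdvantage.Theorems.SosSandwich.QueryFourier

variable {N : ℕ} {W : Type*}

/-! ### The block difference operator `Δ_k` (the `|−⟩⟨−|` part of the index-`k` block) -/

/-- `Δ_k φ (k', b, w) = [k' = k] · (φ(k,b,w) − φ(k,¬b,w))/2`: the component of `φ` on the index-`k` block along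
the target-qubit state `|−⟩` — the part of the block that picks up the sign `(−1)^{x_k}` under the XOR oracle.
[cite: BealsEtAl2001, Lemma 4.1 (proof)] -/
def blockDiff (k : Fin N) (φ : Fin N × Bool × W → ℂ) : Fin N × Bool × W → ℂ :=
  fun s => if s.1 = k then (φ (k, s.2.1, s.2.2) - φ (k, !s.2.1, s.2.2)) / 2 else 0

/-- Unfolding lemma for `blockDiff`. [folklore] -/
@[simp]
theorem blockDiff_apply (k : Fin N) (φ : Fin N × Bool × W → ℂ) (k' : Fin N) (b : Bool) (w : W) :
    blockDiff k φ (k', b, w) = if k' = k then (φ (k, b, w) - φ (k, !b, w)) / 2 else 0 := rfl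

/-- `Δ_k` is linear: it commutes with finite linear combinations. [folklore] -/
theorem blockDiff_sum_smul {ι : Type*} (s : Finset ι) (k : Fin N) (a : ι → ℂ)
    (φ : ι → Fin N × Bool × W → ℂ) :
    blockDiff k (∑ i ∈ s, a i • φ i) = ∑ i ∈ s, a i • blockDiff k (φ i) := by
  funext x
  obtain ⟨k', b, w⟩ := x
  simp only [blockDiff_apply, Finset.sum_apply, Pi.smul_apply, smul_eq_mul]
  by_cases h : k' = k
  · simp only [h, if_true]
    rw [← Finset.sum_sub_distrib, Finset.sum_div]
    refine Finset.sum_congr rfl fun i _ => ?_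
    ring
  · simp [h]

/-- `Δ_k (a • φ) = a • Δ_k φ`. [folklore] -/
theorem blockDiff_smul (k : Fin N) (a : ℂ) (φ : Fin N × Bool × W → ℂ) :
    blockDiff k (a • φ) = a • blockDiff k φ := by
  funext x
  obtain ⟨k', b, w⟩ := x
  simp only [blockDiff_apply, Pi.smul_apply, smul_eq_mul]
  split_ifs <;> ring

/-- A sum of block differences over a set `K` of indices, evaluated at a point: only the block of the point's
own index survives. [folklore] -/
theorem sum_blockDiff_apply (K : Finset (Fin N)) (φ : Fin N → Fin N × Bool × W → ℂ) (k' : Fin N) (b : Bool)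
    (w : W) :
    (∑ k ∈ K, blockDiff k (φ k)) (k', b, w) =
      if k' ∈ K then (φ k' (k', b, w) - φ k' (k', !b, w)) / 2 else 0 := by
  rw [Finset.sum_apply]
  simp only [blockDiff_apply]
  by_cases hk : k' ∈ K
  · rw [if_pos hk, Finset.sum_eq_single k']
    · rw [if_pos rfl]
    · intro k _ hkk
      rw [if_neg (Ne.symm hkk)]
    · intro h; exact absurd hk h
  · rw [if_neg hk]
    refine Finset.sum_eq_zero fun k hkK => ?_
    rw [if_neg]
    rintro rfl
    exact hk hkK

variable [Fintype W]

/-- **Orthogonality of the blocks**: `‖Σ_{k ∈ K} Δ_k φ_k‖² = Σ_{k ∈ K} ‖Δ_k φ_k‖²`. [folklore] -/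
theorem norm_sq_sum_blockDiff (K : Finset (Fin N)) (φ : Fin N → Fin N × Bool × W → ℂ) :
    ∑ s, ‖(∑ k ∈ K, blockDiff k (φ k)) s‖ ^ 2 = ∑ k ∈ K, ∑ s, ‖blockDiff k (φ k) s‖ ^ 2 := by
  -- both sides, written over `s = (k', b, w)`, are `Σ_{k' ∈ K} Σ_{b,w} ‖(φ_{k'}(k',b,w) − φ_{k'}(k',¬b,w))/2‖²`
  have lhs : ∑ s, ‖(∑ k ∈ K, blockDiff k (φ k)) s‖ ^ 2 =
      ∑ k' : Fin N, (if k' ∈ K then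
        ∑ bw : Bool × W, ‖(φ k' (k', bw.1, bw.2) - φ k' (k', !bw.1, bw.2)) / 2‖ ^ 2 else 0) := by
    rw [Fintype.sum_prod_type]
    refine Finset.sum_congr rfl fun k' _ => ?_
    split_ifs with hk
    · refine Finset.sum_congr rfl fun bw _ => ?_
      rw [sum_blockDiff_apply, if_pos hk]
    · refine Finset.sum_eq_zero fun bw _ => ?_
      rw [sum_blockDiff_apply, if_neg hk]; simp
  have rhs : ∀ k ∈ K, ∑ s, ‖blockDiff k (φ k) s‖ ^ 2 =
      ∑ bw : Bool × W, ‖(φ k (k, bw.1, bw.2) - φ k (k, !bw.1, bw.2)) / 2‖ ^ 2 := by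
    intro k _
    rw [Fintype.sum_prod_type, Finset.sum_eq_single k]
    · refine Finset.sum_congr rfl fun bw _ => ?_
      rw [blockDiff_apply, if_pos rfl]
    · intro k' _ hk'
      refine Finset.sum_eq_zero fun bw _ => ?_
      rw [blockDiff_apply, if_neg hk']; simp
    · intro h; exact absurd (Finset.mem_univ k) h
  rw [lhs, Finset.sum_congr rfl rhs, Finset.sum_ite_mem, Finset.univ_inter]

/-- **Bessel for the blocks**: `Σ_k ‖Δ_k φ‖² ≤ ‖φ‖²` (on each pair `{(k,0,w),(k,1,w)}`:
`|a − b|²/2 ≤ |a|² + |b|²`). [folklore] -/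
theorem sum_norm_sq_blockDiff_le (φ : Fin N × Bool × W → ℂ) :
    ∑ k, ∑ s, ‖blockDiff k φ s‖ ^ 2 ≤ ∑ s, ‖φ s‖ ^ 2 := by
  have lhs : ∑ k : Fin N, ∑ s, ‖blockDiff k φ s‖ ^ 2 =
      ∑ k : Fin N, ∑ w : W, ‖φ (k, true, w) - φ (k, false, w)‖ ^ 2 / 2 := by
    refine Finset.sum_congr rfl fun k _ => ?_
    rw [Fintype.sum_prod_type, Finset.sum_eq_single k]
    · rw [Fintype.sum_prod_type, Fintype.sum_bool]
      rw [← Finset.sum_add_distrib]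
      refine Finset.sum_congr rfl fun w _ => ?_
      simp only [blockDiff_apply, if_true, Bool.not_true, Bool.not_false]
      rw [norm_div, norm_div, div_pow, div_pow, ← norm_neg (φ (k, false, w) - φ (k, true, w)), neg_sub]
      norm_num
      ring
    · intro k' _ hk'
      refine Finset.sum_eq_zero fun bw _ => ?_
      obtain ⟨b, w⟩ := bw
      rw [blockDiff_apply, if_neg hk']; simp
    · intro h; exact absurd (Finset.mem_univ k) h
  have rhs : ∑ s, ‖φ s‖ ^ 2 = ∑ k : Fin N, ∑ w : W, (‖φ (k, true, w)‖ ^ 2 + ‖φ (k, false, w)‖ ^ 2) := by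
    rw [Fintype.sum_prod_type]
    refine Finset.sum_congr rfl fun k _ => ?_
    rw [Fintype.sum_prod_type, Fintype.sum_bool, ← Finset.sum_add_distrib]
  rw [lhs, rhs]
  refine Finset.sum_le_sum fun k _ => Finset.sum_le_sum fun w _ => ?_
  have h := norm_sub_le (φ (k, true, w)) (φ (k, false, w))
  have ha := norm_nonneg (φ (k, true, w))
  have hb := norm_nonneg (φ (k, false, w))
  have hs := norm_nonneg (φ (k, true, w) - φ (k, false, w))
  nlinarith [sq_nonneg (‖φ (k, true, w)‖ - ‖φ (k, false, w)‖)]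


/-! ### One oracle step at the new top level, in operator form -/

omit [Fintype W] in
/-- **Top-level step, operator form**: if `Ψ` has Walsh level `≤ t` and `|S| = t + 1`, then
`(OΨ)^(S) = Σ_{k ∈ S} Δ_k Ψ^(S∖k)` (restatement of `QueryFourier.vfc_oracle_top`). [cite: BealsEtAl2001, Lemma 4.1 (proof)] -/
theorem vfc_oracle_top_eq_sum_blockDiff [Fintype W] [DecidableEq W] {t : ℕ}
    {ψ : (Fin N → Bool) → Fin N × Bool × W → ℂ}
    (h : ∀ S : Finset (Fin N), t < S.card → vfc ψ S = 0) {S : Finset (Fin N)} (hS : S.card = t + 1) :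
    vfc (fun x => queryOracle x *ᵥ ψ x) S = ∑ k ∈ S, blockDiff k (vfc ψ (S.erase k)) := by
  funext s
  obtain ⟨k', b, w⟩ := s
  rw [vfc_oracle_top h hS, sum_blockDiff_apply]

/-! ### The creation-operator functional `Γ` -/

/-- `Γ(R) = Σ_{U ⊇ R, |U| = T₂} c_U · Ψ^(U ∖ R)`: the coefficient vector that the weights `c` (on sets of size
`T₂ = 2T`) attach to the "remaining set" `R` — E-G's creation operators read in the Walsh basis.
[cite: EscuderoGutierrez2023, proof of Thm 1.6] -/
def gam (c : Finset (Fin N) → ℂ) (T₂ : ℕ) (ψ : (Fin N → Bool) → Fin N × Bool × W → ℂ) (R : Finset (Fin N)) :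
    Fin N × Bool × W → ℂ :=
  ∑ U ∈ Finset.univ.filter (fun U : Finset (Fin N) => U.card = T₂ ∧ R ⊆ U), c U • vfc ψ (U \ R)

/-- A matrix commutes with the linear combination defining `Γ`. [folklore] -/
theorem mulVec_sum_smul {ι : Type*} (s : Finset ι) (M : Matrix (Fin N × Bool × W) (Fin N × Bool × W) ℂ)
    (a : ι → ℂ) (v : ι → Fin N × Bool × W → ℂ) :
    M *ᵥ (∑ i ∈ s, a i • v i) = ∑ i ∈ s, a i • (M *ᵥ v i) := by
  have : M *ᵥ (∑ i ∈ s, a i • v i) = Matrix.mulVecLin M (∑ i ∈ s, a i • v i) := rfl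
  rw [this, map_sum]
  refine Finset.sum_congr rfl fun i _ => ?_
  rw [map_smul]
  rfl

/-- `Γ` for the state `x ↦ M ψ_x` is `M` applied to `Γ` for `ψ`. [folklore] -/
theorem gam_mulVec (c : Finset (Fin N) → ℂ) (T₂ : ℕ) (M : Matrix (Fin N × Bool × W) (Fin N × Bool × W) ℂ)
    (ψ : (Fin N → Bool) → Fin N × Bool × W → ℂ) (R : Finset (Fin N)) :
    gam c T₂ (fun x => M *ᵥ ψ x) R = M *ᵥ gam c T₂ ψ R := by
  unfold gam
  rw [mulVec_sum_smul]
  refine Finset.sum_congr rfl fun U _ => ?_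
  rw [vfc_mulVec]

/-- Exchange of the two summations `Σ_{U ⊇ R} Σ_{k ∈ U ∖ R} = Σ_{k ∉ R} Σ_{U ⊇ R ∪ {k}}`. [folklore] -/
theorem sum_supset_sum_sdiff {M : Type*} [AddCommMonoid M] (T₂ : ℕ) (R : Finset (Fin N))
    (g : Fin N → Finset (Fin N) → M) :
    ∑ U ∈ Finset.univ.filter (fun U : Finset (Fin N) => U.card = T₂ ∧ R ⊆ U), ∑ k ∈ U \ R, g k U =
      ∑ k ∈ Rᶜ, ∑ U ∈ Finset.univ.filter (fun U : Finset (Fin N) => U.card = T₂ ∧ insert k R ⊆ U), g k U := by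
  rw [Finset.sum_comm' (t' := Rᶜ)
    (s' := fun k => Finset.univ.filter (fun U : Finset (Fin N) => U.card = T₂ ∧ insert k R ⊆ U))]
  intro U k
  simp only [Finset.mem_filter, Finset.mem_univ, true_and, Finset.mem_sdiff, Finset.mem_compl,
    Finset.insert_subset_iff]
  tauto

/-- **The recursion**: for `Ψ` of level `≤ t` and `|R| + (t+1) = T₂`,
`Γ[U(OΨ)](R) = U Σ_{k ∉ R} Δ_k Γ[Ψ](R ∪ {k})`. [cite: EscuderoGutierrez2023, proof of Thm 1.6] -/
theorem gam_step [DecidableEq W] (c : Finset (Fin N) → ℂ) {T₂ t : ℕ}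
    {ψ : (Fin N → Bool) → Fin N × Bool × W → ℂ}
    (h : ∀ S : Finset (Fin N), t < S.card → vfc ψ S = 0)
    (M : Matrix (Fin N × Bool × W) (Fin N × Bool × W) ℂ) {R : Finset (Fin N)} (hR : R.card + (t + 1) = T₂) :
    gam c T₂ (fun x => M *ᵥ (queryOracle x *ᵥ ψ x)) R =
      M *ᵥ ∑ k ∈ Rᶜ, blockDiff k (gam c T₂ ψ (insert k R)) := by
  rw [gam_mulVec]
  congr 1
  unfold gam
  have e1 : ∀ U ∈ Finset.univ.filter (fun U : Finset (Fin N) => U.card = T₂ ∧ R ⊆ U),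
      c U • vfc (fun x => queryOracle x *ᵥ ψ x) (U \ R) =
        ∑ k ∈ U \ R, c U • blockDiff k (vfc ψ (U \ insert k R)) := by
    intro U hU
    rw [Finset.mem_filter] at hU
    have hcard : (U \ R).card = t + 1 := by
      rw [Finset.card_sdiff_of_subset hU.2.2]; omega
    rw [vfc_oracle_top_eq_sum_blockDiff h hcard, Finset.smul_sum]
    refine Finset.sum_congr rfl fun k _ => ?_
    rw [Finset.sdiff_insert]
  rw [Finset.sum_congr rfl e1, sum_supset_sum_sdiff]
  refine Finset.sum_congr rfl fun k _ => ?_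
  rw [blockDiff_sum_smul]

/-- Re-indexing `(R, k ∉ R) ↔ (R ∪ {k}, k)`: `Σ_{|R| = m} Σ_{k ∉ R} h(k, R ∪ {k}) = Σ_{|R'| = m+1} Σ_{k ∈ R'} h(k, R')`.
[folklore] -/
theorem sum_card_sum_compl_insert {M : Type*} [AddCommMonoid M] (m : ℕ) (h : Fin N → Finset (Fin N) → M) :
    ∑ R ∈ Finset.univ.filter (fun R : Finset (Fin N) => R.card = m), ∑ k ∈ Rᶜ, h k (insert k R) =
      ∑ R' ∈ Finset.univ.filter (fun R' : Finset (Fin N) => R'.card = m + 1), ∑ k ∈ R', h k R' := by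
  -- both sides as `Σ_k Σ_{…}`
  rw [Finset.sum_comm' (t' := Finset.univ)
    (s' := fun k => Finset.univ.filter (fun R : Finset (Fin N) => R.card = m ∧ k ∉ R))
    (h := fun R k => by
      simp only [Finset.mem_filter, Finset.mem_univ, true_and, Finset.mem_compl]; tauto)]
  rw [Finset.sum_comm' (s := Finset.univ.filter (fun R' : Finset (Fin N) => R'.card = m + 1)) (t' := Finset.univ)
    (s' := fun k => Finset.univ.filter (fun R' : Finset (Fin N) => R'.card = m + 1 ∧ k ∈ R'))
    (h := fun R k => by
      simp only [Finset.mem_filter, Finset.mem_univ, true_and]; tauto)]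
  refine Finset.sum_congr rfl fun k _ => ?_
  refine Finset.sum_nbij' (fun R => insert k R) (fun R' => R'.erase k) ?_ ?_ ?_ ?_ ?_
  · intro R hR
    simp only [Finset.mem_filter, Finset.mem_univ, true_and] at hR ⊢
    exact ⟨by rw [Finset.card_insert_of_notMem hR.2, hR.1], Finset.mem_insert_self k R⟩
  · intro R' hR'
    simp only [Finset.mem_filter, Finset.mem_univ, true_and] at hR' ⊢
    exact ⟨by rw [Finset.card_erase_of_mem hR'.2, hR'.1]; rfl, Finset.notMem_erase k R'⟩
  · intro R hR
    simp only [Finset.mem_filter, Finset.mem_univ, true_and] at hR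
    exact Finset.erase_insert hR.2
  · intro R' hR'
    simp only [Finset.mem_filter, Finset.mem_univ, true_and] at hR'
    exact Finset.insert_erase hR'.2
  · intro R _
    rfl

/-- **The norm step**: for `Ψ` of level `≤ t`, a unitary `U` and `m + (t+1) = T₂`,
`Σ_{|R| = m} ‖Γ[U(OΨ)](R)‖² = Σ_{|R'| = m+1} Σ_{k ∈ R'} ‖Δ_k Γ[Ψ](R')‖²`. [cite: EscuderoGutierrez2023, proof of Thm 1.6] -/
theorem sum_norm_sq_gam_step [DecidableEq W] (c : Finset (Fin N) → ℂ) {T₂ t m : ℕ}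
    {ψ : (Fin N → Bool) → Fin N × Bool × W → ℂ}
    (h : ∀ S : Finset (Fin N), t < S.card → vfc ψ S = 0)
    {U : Matrix (Fin N × Bool × W) (Fin N × Bool × W) ℂ} (hU : U ∈ Matrix.unitaryGroup (Fin N × Bool × W) ℂ)
    (hm : m + (t + 1) = T₂) :
    ∑ R ∈ Finset.univ.filter (fun R : Finset (Fin N) => R.card = m),
        ∑ s, ‖gam c T₂ (fun x => U *ᵥ (queryOracle x *ᵥ ψ x)) R s‖ ^ 2 =
      ∑ R' ∈ Finset.univ.filter (fun R' : Finset (Fin N) => R'.card = m + 1),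
        ∑ k ∈ R', ∑ s, ‖blockDiff k (gam c T₂ ψ R') s‖ ^ 2 := by
  rw [← sum_card_sum_compl_insert m (fun k R' => ∑ s, ‖blockDiff k (gam c T₂ ψ R') s‖ ^ 2)]
  refine Finset.sum_congr rfl fun R hR => ?_
  rw [Finset.mem_filter] at hR
  rw [gam_step c h U (by rw [hR.2]; exact hm), sum_norm_sq_mulVec_of_mem_unitaryGroup hU,
    norm_sq_sum_blockDiff]

end Summit.QuantumAdvantage.QuantumAdvantage.Theorems.SosSandwich.QueryTopLevel

end
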